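import Mathlib
import Summits.NavierStokesRegularity.NavierStokesRegularity.Theorems.EulerZoomLiouvillePowerGaugeEulerLiouvilleDSSEndpointShellSpread
import Summits.NavierStokesRegularity.NavierStokesRegularity.Theorems.EulerZoomLiouvillePowerGaugeEulerLiouvilleDSSEndpointSobolevSlices
import Summits.NavierStokesRegularity.NavierStokesRegularity.Theorems.EulerZoomLiouvillePowerGaugeEulerLiouvilleDSSEndpointSobolevDecay
import HarnessLib

/-!
# Rung C2 of the crux `EulerZoomLiouville.PowerGaugeEulerLiouville` at the endpoint `ρ = 1/2` (weak class):
# DSS members (any factor) whose period shell energies are `≥ c₀L^{−5+η}`, `η > 25/6`, along unbounded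
# radii are trivial — NO growth hypothesis on the slices

Route №10 `EulerZoomLiouville` (NavierStokesRegularity), crux E = stmt-NavierStokesRegularity-19832,
stub `stub_nonSelfSimilarRest`, binder `¬ (ρ = 1/2 ∧ IsDSSPowerSpread ρ u p)` (the filled DSS endpoint
stratum: POINTWISE two-sided power spread on a period window; the tree's
`DSSEndpointSpread.dss_half_ae_eq_zero_of_shellLower'` widens the lower clause to a period-integrated
shell lower bound `c₀ L^{−5+η}`, `η > 0`, keeping the sublinear upper clause).  Here the sublinear clause
is DROPPED, at the price `η > 25/6`: the growth-free DSS drain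
(`EndpointSobolev.dss_half_periodEnergy_decay_of_weakGradient`, rate `L^{−5/6+ε}`) uses the weak spatial
gradient of the class instead (slice Sobolev + Hölder in time):

* `EndpointSobolev.dss_half_periodEnergy_decay_of_gauge` — PORTRAIT (factor `l ≥ 4`): crux hypotheses
  verbatim at `ρ = 1/2` + DSS ⇒ `∫_{(l^{5/2}τ₀,τ₀)}∫_{L≤|y|<2L}|u|² ≤ C_ε L^{−5/6+ε}`, no growth hypothesis;
* `EndpointSobolev.dss_half_false_of_shellLower_of_weakGradient` — factor `l ≥ 4`: crux hypotheses
  verbatim at `ρ = 1/2`, DSS, `c₀ L^{−5+η} ≤ ∫_{(l^{5/2}τ₀,τ₀)}∫_{L≤|y|<2L}|u(τ,y)|²` for some `c₀ > 0`,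
  `η > 25/6` and radii beyond every bound ⇒ `False`;
* `EndpointSobolev.dss_half_false_of_shellLower_of_weakGradient'` /
  `…dss_half_ae_eq_zero_of_shellLower_of_weakGradient'` — ANY factor `l > 1` (the member is DSS with
  factor `l^k ≥ 4`, `dss_iterate`; the lower bound on the one period bounds the `l^k`-period integral
  from below; no transport of an upper bound is needed any more).

WHAT THIS IS NOT: not NS, not E, not the stub — one DSS endpoint stratum with the growth clause removed
(suggested reading of `IsDSSPowerSpread`: `… ∧ ((sublinear ∧ lower) ∨ (period-shell lower, η > 25/6))`).
[cite: ChaeShvydkoy2013, §3.1 Thm. 3.1; Xue2014DSSEuler, Thm 1.1 (ii)]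
-/

noncomputable section

-- flat `Theorems/<Route><Decl>…` files of one crux share the namespace of the crux (tree convention)
set_option linter.dupNamespace false

open MeasureTheory Set Filter Topology Metric Function TopologicalSpace
open scoped ENNReal NNReal InnerProductSpace RealInnerProductSpace

namespace Summit.NavierStokesRegularity.NavierStokesRegularity.Theorems.PowerGaugeEulerLiouville

open Literature.Analysis Literature.Analysis.FunctionSpaces Literature.Analysis.FluidPDE

namespace EndpointSobolev

section Member

variable {u : ℝ → EuclideanSpace ℝ (Fin 3) → EuclideanSpace ℝ (Fin 3)}
  {p : ℝ → EuclideanSpace ℝ (Fin 3) → ℝ}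
  {H : ℝ → EuclideanSpace ℝ (Fin 3) → EuclideanSpace ℝ (Fin 3) →L[ℝ] EuclideanSpace ℝ (Fin 3)} {c : ℝ≥0}

/-- **Every DSS endpoint member (factor `l ≥ 4`) drains at the rate `L^{−5/6+ε}` — no growth hypothesis
(portrait).**  Crux hypotheses verbatim at `ρ = 1/2` and `u(τ,y) = l^{1+ρ} u(l^{2+ρ}τ, l y)` (`p` accordingly):
for every `ε > 0` there is `C` with `∫_{(l^{5/2}τ₀, τ₀)} ∫_{L≤|y|<2L} |u(τ,y)|² dy dτ ≤ C L^{−5/6+ε}` for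
all `L ≥ 1` (the per-slice class inputs feed `dss_half_periodEnergy_decay_of_weakGradient`).
[cite: ChaeShvydkoy2013, §3.1 proof of Thm. 3.1; Xue2014DSSEuler, Thm 1.1 (ii)] -/
theorem dss_half_periodEnergy_decay_of_gauge {ρ : ℝ} (hρ : ρ = 1 / 2)
    (hsw : IsSuitableWeakSolutionOn (slab (EuclideanSpace ℝ (Fin 3)) (Iio 0) isOpen_Iio) 0 0 u p)
    (hH : HasWeakSpatialGradientOn (slab (EuclideanSpace ℝ (Fin 3)) (Iio 0) isOpen_Iio) u H)
    (hgauge : ∀ a : ℝ, 0 < a →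
      ENNReal.ofReal (a ^ (2 * ρ)) * cknA a (0 : ℝ × EuclideanSpace ℝ (Fin 3)) u +
          ENNReal.ofReal (a ^ ρ) * cknE a (0 : ℝ × EuclideanSpace ℝ (Fin 3)) H +
        ENNReal.ofReal (a ^ (2 * ρ)) * cknD a (0 : ℝ × EuclideanSpace ℝ (Fin 3)) p ≤ (c : ℝ≥0∞))
    {l : ℝ} (hl : 4 ≤ l)
    (hu : ∀ τ : ℝ, τ < 0 → ∀ y, u τ y = (l ^ (1 + ρ)) • u ((l ^ (2 + ρ)) * τ) (l • y))
    (hp : ∀ τ : ℝ, τ < 0 → ∀ y, p τ y = (l ^ (2 * (1 + ρ))) * p ((l ^ (2 + ρ)) * τ) (l • y))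
    {τ₀ : ℝ} (hτ₀ : τ₀ < 0) {ε : ℝ} (hε : 0 < ε) :
    ∃ C : ℝ, ∀ L : ℝ, 1 ≤ L →
      ∫ τ in Ioo ((l ^ (2 + ρ)) * τ₀) τ₀,
          ∫ y in {y : EuclideanSpace ℝ (Fin 3) | L ≤ ‖y‖ ∧ ‖y‖ < 2 * L}, ‖u τ y‖ ^ 2 ≤
        C * L ^ (-(5 / 6 : ℝ) + ε) := by
  subst hρ
  have hl0 : 0 < l := by linarith
  have hA : ∀ a : ℝ, 0 < a → ENNReal.ofReal (a ^ (2 * (1 / 2 : ℝ))) *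
      cknA a (0 : ℝ × EuclideanSpace ℝ (Fin 3)) u ≤ (c : ℝ≥0∞) :=
    fun a ha => le_trans (le_trans le_self_add le_self_add) (hgauge a ha)
  have hE : ∀ a : ℝ, 0 < a → ENNReal.ofReal (a ^ (1 / 2 : ℝ)) *
      cknE a (0 : ℝ × EuclideanSpace ℝ (Fin 3)) H ≤ (c : ℝ≥0∞) :=
    fun a ha => le_trans (le_trans le_add_self le_self_add) (hgauge a ha)
  have hD : ∀ a : ℝ, 0 < a → ENNReal.ofReal (a ^ (2 * (1 / 2 : ℝ))) *
      cknD a (0 : ℝ × EuclideanSpace ℝ (Fin 3)) p ≤ (c : ℝ≥0∞) :=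
    fun a ha => le_trans le_add_self (hgauge a ha)
  have e1 : (1 : ℝ) + 1 / 2 = 3 / 2 := by norm_num
  have e2 : (2 : ℝ) + 1 / 2 = 5 / 2 := by norm_num
  have e3 : l ^ (2 * (1 + 1 / 2 : ℝ)) = l ^ 3 := by
    rw [show (2 : ℝ) * (1 + 1 / 2) = (3 : ℕ) by norm_num, Real.rpow_natCast]
  rw [e2]
  have hu' : ∀ τ : ℝ, τ < 0 → ∀ y, u τ y = (l ^ (3 / 2 : ℝ)) • u (l ^ (5 / 2 : ℝ) * τ) (l • y) := by
    intro τ hτ y; rw [hu τ hτ y, e1, e2]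
  have hp' : ∀ τ : ℝ, τ < 0 → ∀ y, p τ y = l ^ 3 * p (l ^ (5 / 2 : ℝ) * τ) (l • y) := by
    intro τ hτ y; rw [hp τ hτ y, e3, e2]
  have hum : AEStronglyMeasurable (uncurry u)
      (volume.restrict (Iio (0 : ℝ) ×ˢ (univ : Set (EuclideanSpace ℝ (Fin 3))))) := by
    have := hH.locallyIntegrableOn.aestronglyMeasurable
    simpa [slab] using this
  exact dss_half_periodEnergy_decay_of_weakGradient hsw hH hE hl hu' hp' hτ₀
    (ae_slice_energy_of_gauge_half hum hA) (ae_slice_cube_locallyIntegrable hsw)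
    (ae_slice_pressure_velocity_locallyIntegrable hsw) (R₁ := 1)
    (ae_slice_riesz_of_gauge_half_of_weakGradient hsw hH hA hE hD (α := l ^ (5 / 2 : ℝ) * τ₀) hτ₀) hε

/-- **No DSS member (factor `l ≥ 4`) with the period shell lower bound `c₀L^{−5+η}`, `η > 25/6`, in E's
class at `ρ = 1/2` — no growth hypothesis.**  Crux hypotheses verbatim; `u(τ,y) = l^{1+ρ} u(l^{2+ρ}τ, l y)`
(and `p` accordingly) for `τ < 0`; and, for some `c₀ > 0`, `η > 25/6` and radii beyond every bound,
`c₀ L^{−5+η} ≤ ∫_{(l^{5/2}τ₀, τ₀)}∫_{L≤|y|<2L}|u(τ,y)|²`.  Then `False` (per-slice class inputs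
`ae_slice_energy_of_gauge_half`, `ae_slice_cube_locallyIntegrable`,
`ae_slice_pressure_velocity_locallyIntegrable`, `ae_slice_riesz_of_gauge_half_of_weakGradient` feed
`dss_half_period_false_of_shellLower_of_weakGradient`). [cite: ChaeShvydkoy2013, §3.1 Thm. 3.1] -/
theorem dss_half_false_of_shellLower_of_weakGradient {ρ : ℝ} (hρ : ρ = 1 / 2)
    (hsw : IsSuitableWeakSolutionOn (slab (EuclideanSpace ℝ (Fin 3)) (Iio 0) isOpen_Iio) 0 0 u p)
    (hH : HasWeakSpatialGradientOn (slab (EuclideanSpace ℝ (Fin 3)) (Iio 0) isOpen_Iio) u H)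
    (hgauge : ∀ a : ℝ, 0 < a →
      ENNReal.ofReal (a ^ (2 * ρ)) * cknA a (0 : ℝ × EuclideanSpace ℝ (Fin 3)) u +
          ENNReal.ofReal (a ^ ρ) * cknE a (0 : ℝ × EuclideanSpace ℝ (Fin 3)) H +
        ENNReal.ofReal (a ^ (2 * ρ)) * cknD a (0 : ℝ × EuclideanSpace ℝ (Fin 3)) p ≤ (c : ℝ≥0∞))
    {l : ℝ} (hl : 4 ≤ l)
    (hu : ∀ τ : ℝ, τ < 0 → ∀ y, u τ y = (l ^ (1 + ρ)) • u ((l ^ (2 + ρ)) * τ) (l • y))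
    (hp : ∀ τ : ℝ, τ < 0 → ∀ y, p τ y = (l ^ (2 * (1 + ρ))) * p ((l ^ (2 + ρ)) * τ) (l • y))
    {τ₀ : ℝ} (hτ₀ : τ₀ < 0)
    {c₀ η : ℝ} (hc₀ : 0 < c₀) (hη : 25 / 6 < η)
    (hlow : ∀ L₁ : ℝ, ∃ L : ℝ, L₁ ≤ L ∧
      c₀ * L ^ (-(5 : ℝ) + η) ≤
        ∫ τ in Ioo ((l ^ (2 + ρ)) * τ₀) τ₀,
          ∫ y in {y : EuclideanSpace ℝ (Fin 3) | L ≤ ‖y‖ ∧ ‖y‖ < 2 * L}, ‖u τ y‖ ^ 2) : False := by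
  -- adapted from `DSSEndpointSpread.dss_half_false_of_shellLower`
  subst hρ
  have hl0 : 0 < l := by linarith
  have hA : ∀ a : ℝ, 0 < a → ENNReal.ofReal (a ^ (2 * (1 / 2 : ℝ))) *
      cknA a (0 : ℝ × EuclideanSpace ℝ (Fin 3)) u ≤ (c : ℝ≥0∞) :=
    fun a ha => le_trans (le_trans le_self_add le_self_add) (hgauge a ha)
  have hE : ∀ a : ℝ, 0 < a → ENNReal.ofReal (a ^ (1 / 2 : ℝ)) *
      cknE a (0 : ℝ × EuclideanSpace ℝ (Fin 3)) H ≤ (c : ℝ≥0∞) :=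
    fun a ha => le_trans (le_trans le_add_self le_self_add) (hgauge a ha)
  have hD : ∀ a : ℝ, 0 < a → ENNReal.ofReal (a ^ (2 * (1 / 2 : ℝ))) *
      cknD a (0 : ℝ × EuclideanSpace ℝ (Fin 3)) p ≤ (c : ℝ≥0∞) :=
    fun a ha => le_trans le_add_self (hgauge a ha)
  have e1 : (1 : ℝ) + 1 / 2 = 3 / 2 := by norm_num
  have e2 : (2 : ℝ) + 1 / 2 = 5 / 2 := by norm_num
  have e3 : l ^ (2 * (1 + 1 / 2 : ℝ)) = l ^ 3 := by
    rw [show (2 : ℝ) * (1 + 1 / 2) = (3 : ℕ) by norm_num, Real.rpow_natCast]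
  rw [e2] at hlow
  have hu' : ∀ τ : ℝ, τ < 0 → ∀ y, u τ y = (l ^ (3 / 2 : ℝ)) • u (l ^ (5 / 2 : ℝ) * τ) (l • y) := by
    intro τ hτ y; rw [hu τ hτ y, e1, e2]
  have hp' : ∀ τ : ℝ, τ < 0 → ∀ y, p τ y = l ^ 3 * p (l ^ (5 / 2 : ℝ) * τ) (l • y) := by
    intro τ hτ y; rw [hp τ hτ y, e3, e2]
  have hum : AEStronglyMeasurable (uncurry u)
      (volume.restrict (Iio (0 : ℝ) ×ˢ (univ : Set (EuclideanSpace ℝ (Fin 3))))) := by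
    have := hH.locallyIntegrableOn.aestronglyMeasurable
    simpa [slab] using this
  have hEn := ae_slice_energy_of_gauge_half hum hA
  have h3 := ae_slice_cube_locallyIntegrable hsw
  have hPV := ae_slice_pressure_velocity_locallyIntegrable hsw
  have hPR := ae_slice_riesz_of_gauge_half_of_weakGradient hsw hH hA hE hD (α := l ^ (5 / 2 : ℝ) * τ₀) hτ₀
  exact dss_half_period_false_of_shellLower_of_weakGradient hsw hH hE hl hu' hp' hτ₀ hEn h3 hPV
    (R₁ := 1) hPR hc₀ hη hlow

/-- **Any factor `l > 1`.**  A DSS member with factor `l > 1` is DSS with factor `l^k ≥ 4` (`dss_iterate`);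
the shell lower bound on the ONE period `(l^{5/2}τ₀, τ₀)` bounds the integral over the `l^k`-period
`((l^k)^{5/2}τ₀, τ₀) ⊇ (l^{5/2}τ₀, τ₀)` from below (nonnegative integrand); the weak gradient and the gauges
need no transport. [cite: ChaeShvydkoy2013, §3.1 Thm. 3.1; Xue2014DSSEuler, Thm 1.1 (ii)] -/
theorem dss_half_false_of_shellLower_of_weakGradient' {ρ : ℝ} (hρ : ρ = 1 / 2)
    (hsw : IsSuitableWeakSolutionOn (slab (EuclideanSpace ℝ (Fin 3)) (Iio 0) isOpen_Iio) 0 0 u p)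
    (hH : HasWeakSpatialGradientOn (slab (EuclideanSpace ℝ (Fin 3)) (Iio 0) isOpen_Iio) u H)
    (hgauge : ∀ a : ℝ, 0 < a →
      ENNReal.ofReal (a ^ (2 * ρ)) * cknA a (0 : ℝ × EuclideanSpace ℝ (Fin 3)) u +
          ENNReal.ofReal (a ^ ρ) * cknE a (0 : ℝ × EuclideanSpace ℝ (Fin 3)) H +
        ENNReal.ofReal (a ^ (2 * ρ)) * cknD a (0 : ℝ × EuclideanSpace ℝ (Fin 3)) p ≤ (c : ℝ≥0∞))
    {l : ℝ} (hl : 1 < l)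
    (hu : ∀ τ : ℝ, τ < 0 → ∀ y, u τ y = (l ^ (1 + ρ)) • u ((l ^ (2 + ρ)) * τ) (l • y))
    (hp : ∀ τ : ℝ, τ < 0 → ∀ y, p τ y = (l ^ (2 * (1 + ρ))) * p ((l ^ (2 + ρ)) * τ) (l • y))
    {τ₀ : ℝ} (hτ₀ : τ₀ < 0)
    {c₀ η : ℝ} (hc₀ : 0 < c₀) (hη : 25 / 6 < η)
    (hlow : ∀ L₁ : ℝ, ∃ L : ℝ, L₁ ≤ L ∧
      c₀ * L ^ (-(5 : ℝ) + η) ≤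
        ∫ τ in Ioo ((l ^ (2 + ρ)) * τ₀) τ₀,
          ∫ y in {y : EuclideanSpace ℝ (Fin 3) | L ≤ ‖y‖ ∧ ‖y‖ < 2 * L}, ‖u τ y‖ ^ 2) : False := by
  -- adapted from `DSSEndpointSpread.dss_half_false_of_shellLower'` (no upper bound to transport)
  subst hρ
  have hl0 : 0 < l := by linarith
  obtain ⟨k, hk⟩ := pow_unbounded_of_one_lt (4 : ℝ) hl
  have e2 : (2 : ℝ) + 1 / 2 = 5 / 2 := by norm_num
  rw [e2] at hlow
  have eb : (l ^ k) ^ (2 + 1 / 2 : ℝ) = (l ^ (5 / 2 : ℝ)) ^ k := by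
    rw [e2, ← Real.rpow_natCast l k, ← Real.rpow_mul hl0.le, ← Real.rpow_natCast (l ^ (5 / 2 : ℝ)) k,
      ← Real.rpow_mul hl0.le, mul_comm]
  have hA : ∀ a : ℝ, 0 < a → ENNReal.ofReal (a ^ (2 * (1 / 2 : ℝ))) *
      cknA a (0 : ℝ × EuclideanSpace ℝ (Fin 3)) u ≤ (c : ℝ≥0∞) :=
    fun a ha => le_trans (le_trans le_self_add le_self_add) (hgauge a ha)
  have hum : AEStronglyMeasurable (uncurry u)
      (volume.restrict (Iio (0 : ℝ) ×ˢ (univ : Set (EuclideanSpace ℝ (Fin 3))))) := by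
    have := hH.locallyIntegrableOn.aestronglyMeasurable
    simpa [slab] using this
  have hEn := ae_slice_energy_of_gauge_half hum hA
  -- the shell lower bound on the big window `((l^k)^{5/2} τ₀, τ₀) ⊇ (l^{5/2} τ₀, τ₀)`
  set b : ℝ := l ^ (5 / 2 : ℝ) with hb
  have hb1 : 1 < b := Real.one_lt_rpow hl (by norm_num)
  have hbk : (l ^ k) ^ (2 + 1 / 2 : ℝ) * τ₀ ≤ b * τ₀ := by
    rw [eb]
    have hk1 : 1 ≤ k := by
      by_contra h0
      have : k = 0 := by omega
      rw [this, pow_zero] at hk; linarith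
    have hbb : b ≤ b ^ k := le_self_pow₀ hb1.le (by omega)
    nlinarith
  have hlowW : ∀ L₁ : ℝ, ∃ L : ℝ, L₁ ≤ L ∧
      c₀ * L ^ (-(5 : ℝ) + η) ≤
        ∫ τ in Ioo ((l ^ k) ^ (2 + 1 / 2 : ℝ) * τ₀) τ₀,
          ∫ y in {y : EuclideanSpace ℝ (Fin 3) | L ≤ ‖y‖ ∧ ‖y‖ < 2 * L}, ‖u τ y‖ ^ 2 := by
    intro L₁
    obtain ⟨L, hLL₁, hL⟩ := hlow L₁
    refine ⟨L, hLL₁, hL.trans ?_⟩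
    obtain ⟨hif, hnn, -⟩ := period_sliceSetEnergy hum hEn (α := (l ^ k) ^ (2 + 1 / 2 : ℝ) * τ₀) hτ₀
      ((measurableSet_le measurable_const measurable_norm).inter
        (measurableSet_lt measurable_norm measurable_const) :
        MeasurableSet {y : EuclideanSpace ℝ (Fin 3) | L ≤ ‖y‖ ∧ ‖y‖ < 2 * L})
    exact setIntegral_mono_set hif
      ((ae_restrict_iff' measurableSet_Ioo).2 (hnn.mono fun τ hτ hτI => (hτ hτI).1))
      (Ioo_subset_Ioo_left hbk).eventuallyLE
  -- the member is DSS with factor `l^k ≥ 4`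
  obtain ⟨huk, hpk⟩ := dss_iterate hl0 hu hp k
  exact dss_half_false_of_shellLower_of_weakGradient (ρ := 1 / 2) rfl hsw hH hgauge hk.le huk hpk hτ₀
    hc₀ hη hlowW

/-- **The growth-free DSS shell-lower stratum of rung C2 at the endpoint, any factor, `Sig`-shaped**:
vacuously trivial. [cite: ChaeShvydkoy2013, §3.1 Thm. 3.1] -/
theorem dss_half_ae_eq_zero_of_shellLower_of_weakGradient' {ρ : ℝ} (hρ : ρ = 1 / 2)
    (hsw : IsSuitableWeakSolutionOn (slab (EuclideanSpace ℝ (Fin 3)) (Iio 0) isOpen_Iio) 0 0 u p)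
    (hH : HasWeakSpatialGradientOn (slab (EuclideanSpace ℝ (Fin 3)) (Iio 0) isOpen_Iio) u H)
    (hgauge : ∀ a : ℝ, 0 < a →
      ENNReal.ofReal (a ^ (2 * ρ)) * cknA a (0 : ℝ × EuclideanSpace ℝ (Fin 3)) u +
          ENNReal.ofReal (a ^ ρ) * cknE a (0 : ℝ × EuclideanSpace ℝ (Fin 3)) H +
        ENNReal.ofReal (a ^ (2 * ρ)) * cknD a (0 : ℝ × EuclideanSpace ℝ (Fin 3)) p ≤ (c : ℝ≥0∞))
    {l : ℝ} (hl : 1 < l)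
    (hu : ∀ τ : ℝ, τ < 0 → ∀ y, u τ y = (l ^ (1 + ρ)) • u ((l ^ (2 + ρ)) * τ) (l • y))
    (hp : ∀ τ : ℝ, τ < 0 → ∀ y, p τ y = (l ^ (2 * (1 + ρ))) * p ((l ^ (2 + ρ)) * τ) (l • y))
    {τ₀ : ℝ} (hτ₀ : τ₀ < 0)
    {c₀ η : ℝ} (hc₀ : 0 < c₀) (hη : 25 / 6 < η)
    (hlow : ∀ L₁ : ℝ, ∃ L : ℝ, L₁ ≤ L ∧
      c₀ * L ^ (-(5 : ℝ) + η) ≤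
        ∫ τ in Ioo ((l ^ (2 + ρ)) * τ₀) τ₀,
          ∫ y in {y : EuclideanSpace ℝ (Fin 3) | L ≤ ‖y‖ ∧ ‖y‖ < 2 * L}, ‖u τ y‖ ^ 2) :
    uncurry u =ᵐ[volume.restrict (Iio (0 : ℝ) ×ˢ (univ : Set (EuclideanSpace ℝ (Fin 3))))] 0 :=
  (dss_half_false_of_shellLower_of_weakGradient' hρ hsw hH hgauge hl hu hp hτ₀ hc₀ hη hlow).elim

/-- **Every DSS endpoint member, ANY factor `l > 1`, drains at the rate `L^{−5/6+ε}` — no growth hypothesis (portrait).**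
The member is DSS with factor `l^k ≥ 4` (`dss_iterate`); `dss_half_periodEnergy_decay_of_gauge` bounds the `l^k`-period integral, which
dominates the one-period integral over `(l^{5/2}τ₀, τ₀) ⊆ ((l^k)^{5/2}τ₀, τ₀)` (nonnegative integrand).
[cite: ChaeShvydkoy2013, §3.1 proof of Thm. 3.1; Xue2014DSSEuler, Thm 1.1 (ii)] -/
theorem dss_half_periodEnergy_decay_of_gauge' {ρ : ℝ} (hρ : ρ = 1 / 2)
    (hsw : IsSuitableWeakSolutionOn (slab (EuclideanSpace ℝ (Fin 3)) (Iio 0) isOpen_Iio) 0 0 u p)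
    (hH : HasWeakSpatialGradientOn (slab (EuclideanSpace ℝ (Fin 3)) (Iio 0) isOpen_Iio) u H)
    (hgauge : ∀ a : ℝ, 0 < a →
      ENNReal.ofReal (a ^ (2 * ρ)) * cknA a (0 : ℝ × EuclideanSpace ℝ (Fin 3)) u +
          ENNReal.ofReal (a ^ ρ) * cknE a (0 : ℝ × EuclideanSpace ℝ (Fin 3)) H +
        ENNReal.ofReal (a ^ (2 * ρ)) * cknD a (0 : ℝ × EuclideanSpace ℝ (Fin 3)) p ≤ (c : ℝ≥0∞))
    {l : ℝ} (hl : 1 < l)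
    (hu : ∀ τ : ℝ, τ < 0 → ∀ y, u τ y = (l ^ (1 + ρ)) • u ((l ^ (2 + ρ)) * τ) (l • y))
    (hp : ∀ τ : ℝ, τ < 0 → ∀ y, p τ y = (l ^ (2 * (1 + ρ))) * p ((l ^ (2 + ρ)) * τ) (l • y))
    {τ₀ : ℝ} (hτ₀ : τ₀ < 0) {ε : ℝ} (hε : 0 < ε) :
    ∃ C : ℝ, ∀ L : ℝ, 1 ≤ L →
      ∫ τ in Ioo ((l ^ (2 + ρ)) * τ₀) τ₀,
          ∫ y in {y : EuclideanSpace ℝ (Fin 3) | L ≤ ‖y‖ ∧ ‖y‖ < 2 * L}, ‖u τ y‖ ^ 2 ≤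
        C * L ^ (-(5 / 6 : ℝ) + ε) := by
  subst hρ
  have hl0 : 0 < l := by linarith
  obtain ⟨k, hk⟩ := pow_unbounded_of_one_lt (4 : ℝ) hl
  have e2 : (2 : ℝ) + 1 / 2 = 5 / 2 := by norm_num
  rw [e2]
  have eb : (l ^ k) ^ (2 + 1 / 2 : ℝ) = (l ^ (5 / 2 : ℝ)) ^ k := by
    rw [e2, ← Real.rpow_natCast l k, ← Real.rpow_mul hl0.le, ← Real.rpow_natCast (l ^ (5 / 2 : ℝ)) k,
      ← Real.rpow_mul hl0.le, mul_comm]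
  have hA : ∀ a : ℝ, 0 < a → ENNReal.ofReal (a ^ (2 * (1 / 2 : ℝ))) *
      cknA a (0 : ℝ × EuclideanSpace ℝ (Fin 3)) u ≤ (c : ℝ≥0∞) :=
    fun a ha => le_trans (le_trans le_self_add le_self_add) (hgauge a ha)
  have hum : AEStronglyMeasurable (uncurry u)
      (volume.restrict (Iio (0 : ℝ) ×ˢ (univ : Set (EuclideanSpace ℝ (Fin 3))))) := by
    have := hH.locallyIntegrableOn.aestronglyMeasurable
    simpa [slab] using this
  have hEn := ae_slice_energy_of_gauge_half hum hA
  set b : ℝ := l ^ (5 / 2 : ℝ) with hb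
  have hb1 : 1 < b := Real.one_lt_rpow hl (by norm_num)
  have hbk : (l ^ k) ^ (2 + 1 / 2 : ℝ) * τ₀ ≤ b * τ₀ := by
    rw [eb]
    have hk1 : 1 ≤ k := by
      by_contra h0
      have : k = 0 := by omega
      rw [this, pow_zero] at hk; linarith
    have hbb : b ≤ b ^ k := le_self_pow₀ hb1.le (by omega)
    nlinarith
  obtain ⟨huk, hpk⟩ := dss_iterate hl0 hu hp k
  obtain ⟨C, hC⟩ := dss_half_periodEnergy_decay_of_gauge (ρ := 1 / 2) rfl hsw hH hgauge hk.le huk hpk hτ₀ hε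
  refine ⟨C, fun L hL => le_trans ?_ (hC L hL)⟩
  obtain ⟨hif, hnn, -⟩ := period_sliceSetEnergy hum hEn (α := (l ^ k) ^ (2 + 1 / 2 : ℝ) * τ₀) hτ₀
    ((measurableSet_le measurable_const measurable_norm).inter
      (measurableSet_lt measurable_norm measurable_const) :
      MeasurableSet {y : EuclideanSpace ℝ (Fin 3) | L ≤ ‖y‖ ∧ ‖y‖ < 2 * L})
  exact setIntegral_mono_set hif
    ((ae_restrict_iff' measurableSet_Ioo).2 (hnn.mono fun τ hτ hτI => (hτ hτI).1))
    (Ioo_subset_Ioo_left hbk).eventuallyLE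

end Member

end EndpointSobolev

end Summit.NavierStokesRegularity.NavierStokesRegularity.Theorems.PowerGaugeEulerLiouville
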